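import Summits.CriticalPhenomena.PercolationContinuityZ3.Theorems.PercNearOneGluingAdditiveGluingBystanderKernel
import Summits.CriticalPhenomena.PercolationContinuityZ3.Theorems.PercNearOneGluingAdditiveGluingWholeBlockKernel3
import HarnessLib

/-! # Crux `PercNearOneGluing.AdditiveGluing` (stmt-CriticalPhenomena-4576) — the BYSTANDER kernel with PER-LAYER
# admissible designations (exchange-certificate form CERT⁺⁺⁺ of `stub_bystanderCert_c5`, seat (d) round 3)

Support file (`--supports stmt-CriticalPhenomena-4576`); no definitions, no named facts.  CONDITIONAL result: block goodness
from a certificate.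

Setting of skeleton v8 (`stub_bystanderKernel_c5` ∘ `stub_bystanderCert_c5`): weighting `u`, relays `A ∋ b`, block `S` of non-relays,
un-glued minimiser `a₀`, a bystander `x' ∈ S` with a positive edge, the layers `L_B = {open star of x' = B}`, the layer weightings
`q_B = (u − x')/B` and the layer blocks `T_B = (S ∖ x') ∪ B`.  The v8 certificate benchmarks every relay-free layer by ONE minimiser
`a'` of `τ_{u−x'}`; the certificate accepted here (`bystanderKernel3`) is the exchange-certificate case split of the bystander expansion:
* relay layers (`T_B ∩ A ≠ ∅`): the exact term `reach_{q_B}(T_B) − [τ_{q_B}(a₀) + gain_{q_B}(a₀, T_B)]`, a set exchange `E_{T_B}(a₀)`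
  (non-negative as soon as SOME vertex of `T_B` — a relay of `B` or another vertex of the block — is at least as reliable as `a₀`
  under `q_B`, by `exchCert_condHmin`; negative relay layers are paid by the others);
* relay-free layers: `[τ + gain]_{q_B}(d_B) − [τ + gain]_{q_B}(a₀)` for a PER-LAYER designation `d_B` that is a minimiser of ANY
  weighting `w_B` with fewer positive-degree vertices agreeing with `q_B` off the pairs inside `T_B` and the pairs `d_B–T_B`
  (`blockSlack_transfer`), or the same after deleting the pairs `a₀–T_B` from `q_B`, scaled by `μ_{q_B}(a₀–T_B closed)`
  (`kernelPin_slack_eq`).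
Numerics (this seat, lab/t5–t6 + kit census): with these two freedoms EVERY bystander certifies in all random n ≤ 8 drift instances
met and on the lead-c5 contested instance (x' = 4: −1.0e−4 → +2.8e−3); on the two annealed WB witnesses one of the two bystanders still
fails, the other certifies — so the residual `∃ x'` form keeps 0 violations.  [cite: KozmaNitzan2024, §3.2 pp. 12–14, Question 9 p. 36]
-/

namespace Summit.CriticalPhenomena.PercolationContinuityZ3.Theorems

open MeasureTheory Set
open Literature.Probability.LatticeModels (prodBernoulli)
open Literature.Probability.Percolation (BondConfig openConn openConnIn openGraph openCluster)
open scoped BigOperators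

noncomputable section
open Classical

section BystanderKernel3

open Literature.Probability.LatticeModels Literature.Probability.Percolation

variable {n : ℕ}

/-- **The bystander kernel with per-layer admissible designations** (CERT⁺⁺⁺ form of the v8 residual).  See the module docstring.
[cite: KozmaNitzan2024, §3.2 pp. 12–14] -/
theorem bystanderKernel3 :
    ∀ (n : ℕ) (u : Sym2 (Fin n) → unitInterval) (A S : Finset (Fin n)) (b a₀ x' : Fin n) (hb : b ∈ A)
      (d : Finset (Fin n) → Fin n) (w : Finset (Fin n) → Sym2 (Fin n) → unitInterval) (modeB : Finset (Fin n) → Bool),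
      Disjoint S A → a₀ ∈ A → x' ∈ S →
      (∀ a ∈ A, (prodBernoulli u).real (openConn a₀ b) ≤ (prodBernoulli u).real (openConn a b)) →
      (∀ B : Finset (Fin n), d B ∈ A) →
      (∀ B : Finset (Fin n), Disjoint (S.erase x' ∪ B) A → (prodBernoulli u).real {ω : BondConfig (Fin n) | ∀ y : Fin n, y ∈ B ↔ (y ∉ ({x'} : Finset (Fin n)) ∧ ∃ o ∈ ({x'} : Finset (Fin n)), s(o, y) ∈ ω)} ≠ 0 →
        ∀ a ∈ A, (prodBernoulli (w B)).real (openConn (d B) b) ≤ (prodBernoulli (w B)).real (openConn a b)) →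
      (∀ B : Finset (Fin n), Disjoint (S.erase x' ∪ B) A → (prodBernoulli u).real {ω : BondConfig (Fin n) | ∀ y : Fin n, y ∈ B ↔ (y ∉ ({x'} : Finset (Fin n)) ∧ ∃ o ∈ ({x'} : Finset (Fin n)), s(o, y) ∈ ω)} ≠ 0 →
        (Finset.univ.filter (fun v : Fin n => ∃ y : Fin n, 0 < (w B s(y, v) : ℝ))).card
          < (Finset.univ.filter (fun v : Fin n => ∃ y : Fin n, 0 < (u s(y, v) : ℝ))).card) →
      (∀ B : Finset (Fin n), Disjoint (S.erase x' ∪ B) A → (prodBernoulli u).real {ω : BondConfig (Fin n) | ∀ y : Fin n, y ∈ B ↔ (y ∉ ({x'} : Finset (Fin n)) ∧ ∃ o ∈ ({x'} : Finset (Fin n)), s(o, y) ∈ ω)} ≠ 0 → ∀ e : Sym2 (Fin n),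
        ¬ ((∀ y ∈ e, y ∈ (S.erase x' ∪ B)) ∧ ¬ e.IsDiag) → ¬ (d B ∈ e ∧ ∃ y ∈ e, y ∈ (S.erase x' ∪ B)) →
        w B e = (if modeB B = true then (fun e : Sym2 (Fin n) => if a₀ ∈ e ∧ (∃ y ∈ e, y ∈ (S.erase x' ∪ B)) then (0 : unitInterval) else if (∀ y ∈ e, y ∈ B) ∧ ¬ e.IsDiag then 1 else if (∃ y ∈ e, y ∈ ({x'} : Finset (Fin n))) then 0 else u e) e else (fun e : Sym2 (Fin n) => if (∀ y ∈ e, y ∈ B) ∧ ¬ e.IsDiag then 1 else if (∃ y ∈ e, y ∈ ({x'} : Finset (Fin n))) then 0 else u e) e)) →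
      (∀ B : Finset (Fin n), Disjoint (S.erase x' ∪ B) A → (prodBernoulli u).real {ω : BondConfig (Fin n) | ∀ y : Fin n, y ∈ B ↔ (y ∉ ({x'} : Finset (Fin n)) ∧ ∃ o ∈ ({x'} : Finset (Fin n)), s(o, y) ∈ ω)} ≠ 0 →
        0 < (prodBernoulli (w B)).real {ω : BondConfig (Fin n) | ∀ y ∈ (S.erase x' ∪ B), s(d B, y) ∉ ω}) →
      (∀ w' : Sym2 (Fin n) → unitInterval,
        (Finset.univ.filter (fun v : Fin n => ∃ y : Fin n, 0 < (w' s(y, v) : ℝ))).card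
          < (Finset.univ.filter (fun v : Fin n => ∃ y : Fin n, 0 < (u s(y, v) : ℝ))).card →
        ∀ (A' S' : Finset (Fin n)) (b' d' : Fin n) (hb' : b' ∈ A'), Disjoint S' A' → d' ∈ A' →
        (∀ a ∈ A', (prodBernoulli w').real (openConn d' b') ≤ (prodBernoulli w').real (openConn a b')) →
        (prodBernoulli w').real (openConn d' b')
          + (prodBernoulli w').real
              ((openConn d' b')ᶜ ∩ (⋃ v ∈ S', openConn d' v) ∩ (⋃ v ∈ S', openConn v b'))
        ≤ (prodBernoulli w').real (⋃ v ∈ S', openConn v b')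
          + (∑ W ∈ (Finset.univ : Finset (Finset (Fin n))).filter (fun W => Disjoint W A'),
              (prodBernoulli w').real
                  {ω : BondConfig (Fin n) | ∀ z : Fin n, (z ∈ W ↔ ω ∈ ⋃ v ∈ S', openConn v z)}
                * A'.inf' ⟨b', hb'⟩ (fun a => (prodBernoulli w').real (openConnIn ((W : Set (Fin n))ᶜ) a b')))) →
      0 ≤ ∑ B : Finset (Fin n), (prodBernoulli u).real {ω : BondConfig (Fin n) | ∀ y : Fin n, y ∈ B ↔ (y ∉ ({x'} : Finset (Fin n)) ∧ ∃ o ∈ ({x'} : Finset (Fin n)), s(o, y) ∈ ω)}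
          * (if Disjoint (S.erase x' ∪ B) A then
              (if modeB B = true then
                  (prodBernoulli (fun e : Sym2 (Fin n) => if (∀ y ∈ e, y ∈ B) ∧ ¬ e.IsDiag then 1 else if (∃ y ∈ e, y ∈ ({x'} : Finset (Fin n))) then 0 else u e)).real {ω : BondConfig (Fin n) | ∀ y ∈ (S.erase x' ∪ B), s(a₀, y) ∉ ω}
                    * (((prodBernoulli (fun e : Sym2 (Fin n) => if a₀ ∈ e ∧ (∃ y ∈ e, y ∈ (S.erase x' ∪ B)) then (0 : unitInterval) else if (∀ y ∈ e, y ∈ B) ∧ ¬ e.IsDiag then 1 else if (∃ y ∈ e, y ∈ ({x'} : Finset (Fin n))) then 0 else u e)).real (openConn (d B) b) + (prodBernoulli (fun e : Sym2 (Fin n) => if a₀ ∈ e ∧ (∃ y ∈ e, y ∈ (S.erase x' ∪ B)) then (0 : unitInterval) else if (∀ y ∈ e, y ∈ B) ∧ ¬ e.IsDiag then 1 else if (∃ y ∈ e, y ∈ ({x'} : Finset (Fin n))) then 0 else u e)).real ((openConn (d B) b)ᶜ ∩ (⋃ v ∈ (S.erase x' ∪ B), openConn (d B) v) ∩ (⋃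 v ∈ (S.erase x' ∪ B), openConn v b)))
                       - ((prodBernoulli (fun e : Sym2 (Fin n) => if a₀ ∈ e ∧ (∃ y ∈ e, y ∈ (S.erase x' ∪ B)) then (0 : unitInterval) else if (∀ y ∈ e, y ∈ B) ∧ ¬ e.IsDiag then 1 else if (∃ y ∈ e, y ∈ ({x'} : Finset (Fin n))) then 0 else u e)).real (openConn a₀ b) + (prodBernoulli (fun e : Sym2 (Fin n) => if a₀ ∈ e ∧ (∃ y ∈ e, y ∈ (S.erase x' ∪ B)) then (0 : unitInterval) else if (∀ y ∈ e, y ∈ B) ∧ ¬ e.IsDiag then 1 else if (∃ y ∈ e, y ∈ ({x'} : Finset (Fin n))) then 0 else u e)).real ((openConn a₀ b)ᶜ ∩ (⋃ v ∈ (S.erase x' ∪ B), openConn a₀ v) ∩ (⋃ v ∈ (S.erase x' ∪ B), openConn v b))))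
                else (((prodBernoulli (fun e : Sym2 (Fin n) => if (∀ y ∈ e, y ∈ B) ∧ ¬ e.IsDiag then 1 else if (∃ y ∈ e, y ∈ ({x'} : Finset (Fin n))) then 0 else u e)).real (openConn (d B) b) + (prodBernoulli (fun e : Sym2 (Fin n) => if (∀ y ∈ e, y ∈ B) ∧ ¬ e.IsDiag then 1 else if (∃ y ∈ e, y ∈ ({x'} : Finset (Fin n))) then 0 else u e)).real ((openConn (d B) b)ᶜ ∩ (⋃ v ∈ (S.erase x' ∪ B), openConn (d B) v) ∩ (⋃ v ∈ (S.erase x' ∪ B), openConn v b)))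
                       - ((prodBernoulli (fun e : Sym2 (Fin n) => if (∀ y ∈ e, y ∈ B) ∧ ¬ e.IsDiag then 1 else if (∃ y ∈ e, y ∈ ({x'} : Finset (Fin n))) then 0 else u e)).real (openConn a₀ b) + (prodBernoulli (fun e : Sym2 (Fin n) => if (∀ y ∈ e, y ∈ B) ∧ ¬ e.IsDiag then 1 else if (∃ y ∈ e, y ∈ ({x'} : Finset (Fin n))) then 0 else u e)).real ((openConn a₀ b)ᶜ ∩ (⋃ v ∈ (S.erase x' ∪ B), openConn a₀ v) ∩ (⋃ v ∈ (S.erase x' ∪ B), openConn v b)))))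
            else
              ((prodBernoulli (fun e : Sym2 (Fin n) => if (∀ y ∈ e, y ∈ B) ∧ ¬ e.IsDiag then 1 else if (∃ y ∈ e, y ∈ ({x'} : Finset (Fin n))) then 0 else u e)).real (⋃ v ∈ (S.erase x' ∪ B), openConn v b)
                - ((prodBernoulli (fun e : Sym2 (Fin n) => if (∀ y ∈ e, y ∈ B) ∧ ¬ e.IsDiag then 1 else if (∃ y ∈ e, y ∈ ({x'} : Finset (Fin n))) then 0 else u e)).real (openConn a₀ b) + (prodBernoulli (fun e : Sym2 (Fin n) => if (∀ y ∈ e, y ∈ B) ∧ ¬ e.IsDiag then 1 else if (∃ y ∈ e, y ∈ ({x'} : Finset (Fin n))) then 0 else u e)).real ((openConn a₀ b)ᶜ ∩ (⋃ v ∈ (S.erase x' ∪ B), openConn a₀ v) ∩ (⋃ v ∈ (S.erase x' ∪ B), openConn v b))))) →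
      (prodBernoulli u).real (openConn a₀ b)
          + (prodBernoulli u).real
              ((openConn a₀ b)ᶜ ∩ (⋃ v ∈ S, openConn a₀ v) ∩ (⋃ v ∈ S, openConn v b))
        ≤ (prodBernoulli u).real (⋃ v ∈ S, openConn v b)
          + (∑ W ∈ (Finset.univ : Finset (Finset (Fin n))).filter (fun W => Disjoint W A),
              (prodBernoulli u).real
                  {ω : BondConfig (Fin n) | ∀ z : Fin n, (z ∈ W ↔ ω ∈ ⋃ v ∈ S, openConn v z)}
                * A.inf' ⟨b, hb⟩ (fun a => (prodBernoulli u).real (openConnIn ((W : Set (Fin n))ᶜ) a b))) := by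
  intro n u A S b a₀ x' hb d w modeB hSA ha₀ hx' hmin hdA hwmin hwcard hwagree hwpos hblk hsum
  have hx'A : x' ∉ A := Finset.disjoint_left.1 hSA hx'
  have ha₀x : a₀ ≠ x' := fun h => hx'A (h ▸ ha₀)
  have hxT : x' ∉ S.erase x' := Finset.notMem_erase x' S
  rw [← Finset.insert_erase hx']
  refine stub_bystanderLayers_c5 n u A (S.erase x') x' b a₀ hb
    (fun B => (if Disjoint (S.erase x' ∪ B) A then
              (if modeB B = true then
                  (prodBernoulli (fun e : Sym2 (Fin n) => if (∀ y ∈ e, y ∈ B) ∧ ¬ e.IsDiag then 1 else if (∃ y ∈ e, y ∈ ({x'} : Finset (Fin n))) then 0 else u e)).real {ω : BondConfig (Fin n) | ∀ y ∈ (S.erase x' ∪ B), s(a₀, y) ∉ ω}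
                    * (((prodBernoulli (fun e : Sym2 (Fin n) => if a₀ ∈ e ∧ (∃ y ∈ e, y ∈ (S.erase x' ∪ B)) then (0 : unitInterval) else if (∀ y ∈ e, y ∈ B) ∧ ¬ e.IsDiag then 1 else if (∃ y ∈ e, y ∈ ({x'} : Finset (Fin n))) then 0 else u e)).real (openConn (d B) b) + (prodBernoulli (fun e : Sym2 (Fin n) => if a₀ ∈ e ∧ (∃ y ∈ e, y ∈ (S.erase x' ∪ B)) then (0 : unitInterval) else if (∀ y ∈ e, y ∈ B) ∧ ¬ e.IsDiag then 1 else if (∃ y ∈ e, y ∈ ({x'} : Finset (Fin n))) then 0 else u e)).real ((openConn (d B) b)ᶜ ∩ (⋃ v ∈ (S.erase x' ∪ B), openConn (d B) v) ∩ (⋃ v ∈ (S.erase x' ∪ B), openConn v b)))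
                       - ((prodBernoulli (fun e : Sym2 (Fin n) => if a₀ ∈ e ∧ (∃ y ∈ e, y ∈ (S.erase x' ∪ B)) then (0 : unitInterval) else if (∀ y ∈ e, y ∈ B) ∧ ¬ e.IsDiag then 1 else if (∃ y ∈ e, y ∈ ({x'} : Finset (Fin n))) then 0 else u e)).real (openConn a₀ b) + (prodBernoulli (fun e : Sym2 (Fin n) => if a₀ ∈ e ∧ (∃ y ∈ e, y ∈ (S.erase x' ∪ B)) then (0 : unitInterval) else if (∀ y ∈ e, y ∈ B) ∧ ¬ e.IsDiag then 1 else if (∃ y ∈ e, y ∈ ({x'} : Finset (Fin n))) then 0 else u e)).real ((openConn a₀ b)ᶜ ∩ (⋃ v ∈ (S.erase x' ∪ B), openConn a₀ v) ∩ (⋃ v ∈ (S.erase x' ∪ B), openConn v b))))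
                else (((prodBernoulli (fun e : Sym2 (Fin n) => if (∀ y ∈ e, y ∈ B) ∧ ¬ e.IsDiag then 1 else if (∃ y ∈ e, y ∈ ({x'} : Finset (Fin n))) then 0 else u e)).real (openConn (d B) b) + (prodBernoulli (fun e : Sym2 (Fin n) => if (∀ y ∈ e, y ∈ B) ∧ ¬ e.IsDiag then 1 else if (∃ y ∈ e, y ∈ ({x'} : Finset (Fin n))) then 0 else u e)).real ((openConn (d B) b)ᶜ ∩ (⋃ v ∈ (S.erase x' ∪ B), openConn (d B) v) ∩ (⋃ v ∈ (S.erase x' ∪ B), openConn v b)))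
                       - ((prodBernoulli (fun e : Sym2 (Fin n) => if (∀ y ∈ e, y ∈ B) ∧ ¬ e.IsDiag then 1 else if (∃ y ∈ e, y ∈ ({x'} : Finset (Fin n))) then 0 else u e)).real (openConn a₀ b) + (prodBernoulli (fun e : Sym2 (Fin n) => if (∀ y ∈ e, y ∈ B) ∧ ¬ e.IsDiag then 1 else if (∃ y ∈ e, y ∈ ({x'} : Finset (Fin n))) then 0 else u e)).real ((openConn a₀ b)ᶜ ∩ (⋃ v ∈ (S.erase x' ∪ B), openConn a₀ v) ∩ (⋃ v ∈ (S.erase x' ∪ B), openConn v b)))))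
            else
              ((prodBernoulli (fun e : Sym2 (Fin n) => if (∀ y ∈ e, y ∈ B) ∧ ¬ e.IsDiag then 1 else if (∃ y ∈ e, y ∈ ({x'} : Finset (Fin n))) then 0 else u e)).real (⋃ v ∈ (S.erase x' ∪ B), openConn v b)
                - ((prodBernoulli (fun e : Sym2 (Fin n) => if (∀ y ∈ e, y ∈ B) ∧ ¬ e.IsDiag then 1 else if (∃ y ∈ e, y ∈ ({x'} : Finset (Fin n))) then 0 else u e)).real (openConn a₀ b) + (prodBernoulli (fun e : Sym2 (Fin n) => if (∀ y ∈ e, y ∈ B) ∧ ¬ e.IsDiag then 1 else if (∃ y ∈ e, y ∈ ({x'} : Finset (Fin n))) then 0 else u e)).real ((openConn a₀ b)ᶜ ∩ (⋃ v ∈ (S.erase x' ∪ B), openConn a₀ v) ∩ (⋃ v ∈ (S.erase x' ∪ B), openConn v b)))))) hxT hx'A ha₀x hsum ?_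
  intro B hB
  have hpk0 : 0 ≤ (∑ W ∈ (Finset.univ : Finset (Finset (Fin n))).filter (fun W => Disjoint W A),
              (prodBernoulli (fun e : Sym2 (Fin n) => if (∀ y ∈ e, y ∈ B) ∧ ¬ e.IsDiag then 1 else if (∃ y ∈ e, y ∈ ({x'} : Finset (Fin n))) then 0 else u e)).real
                  {ω : BondConfig (Fin n) | ∀ z : Fin n, (z ∈ W ↔ ω ∈ ⋃ v ∈ (S.erase x' ∪ B), openConn v z)}
                * A.inf' ⟨b, hb⟩ (fun a => (prodBernoulli (fun e : Sym2 (Fin n) => if (∀ y ∈ e, y ∈ B) ∧ ¬ e.IsDiag then 1 else if (∃ y ∈ e, y ∈ ({x'} : Finset (Fin n))) then 0 else u e)).real (openConnIn ((W : Set (Fin n))ᶜ) a b))) :=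
    Finset.sum_nonneg fun W _ => mul_nonneg measureReal_nonneg (Finset.le_inf' _ _ fun a _ => measureReal_nonneg)
  show (if Disjoint (S.erase x' ∪ B) A then
              (if modeB B = true then
                  (prodBernoulli (fun e : Sym2 (Fin n) => if (∀ y ∈ e, y ∈ B) ∧ ¬ e.IsDiag then 1 else if (∃ y ∈ e, y ∈ ({x'} : Finset (Fin n))) then 0 else u e)).real {ω : BondConfig (Fin n) | ∀ y ∈ (S.erase x' ∪ B), s(a₀, y) ∉ ω}
                    * (((prodBernoulli (fun e : Sym2 (Fin n) => if a₀ ∈ e ∧ (∃ y ∈ e, y ∈ (S.erase x' ∪ B)) then (0 : unitInterval) else if (∀ y ∈ e, y ∈ B) ∧ ¬ e.IsDiag then 1 else if (∃ y ∈ e, y ∈ ({x'} : Finset (Fin n))) then 0 else u e)).real (openConn (d B) b) + (prodBernoulli (fun e : Sym2 (Fin n) => if a₀ ∈ e ∧ (∃ y ∈ e, y ∈ (S.erase x' ∪ B)) then (0 : unitInterval) else if (∀ y ∈ e, y ∈ B) ∧ ¬ e.IsDiag then 1 else if (∃ y ∈ e, y ∈ ({x'} : Finset (Fin n))) then 0 else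 u e)).real ((openConn (d B) b)ᶜ ∩ (⋃ v ∈ (S.erase x' ∪ B), openConn (d B) v) ∩ (⋃ v ∈ (S.erase x' ∪ B), openConn v b)))
                       - ((prodBernoulli (fun e : Sym2 (Fin n) => if a₀ ∈ e ∧ (∃ y ∈ e, y ∈ (S.erase x' ∪ B)) then (0 : unitInterval) else if (∀ y ∈ e, y ∈ B) ∧ ¬ e.IsDiag then 1 else if (∃ y ∈ e, y ∈ ({x'} : Finset (Fin n))) then 0 else u e)).real (openConn a₀ b) + (prodBernoulli (fun e : Sym2 (Fin n) => if a₀ ∈ e ∧ (∃ y ∈ e, y ∈ (S.erase x' ∪ B)) then (0 : unitInterval) else if (∀ y ∈ e, y ∈ B) ∧ ¬ e.IsDiag then 1 else if (∃ y ∈ e, y ∈ ({x'} : Finset (Fin n))) then 0 else u e)).real ((openConn a₀ b)ᶜ ∩ (⋃ v ∈ (S.erase x' ∪ B), openConn a₀ v) ∩ (⋃ v ∈ (S.erase x' ∪ B), openConn v b))))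
                else (((prodBernoulli (fun e : Sym2 (Fin n) => if (∀ y ∈ e, y ∈ B) ∧ ¬ e.IsDiag then 1 else if (∃ y ∈ e, y ∈ ({x'} : Finset (Fin n))) then 0 else u e)).real (openConn (d B) b) + (prodBernoulli (fun e : Sym2 (Fin n) => if (∀ y ∈ e, y ∈ B) ∧ ¬ e.IsDiag then 1 else if (∃ y ∈ e, y ∈ ({x'} : Finset (Fin n))) then 0 else u e)).real ((openConn (d B) b)ᶜ ∩ (⋃ v ∈ (S.erase x' ∪ B), openConn (d B) v) ∩ (⋃ v ∈ (S.erase x' ∪ B), openConn v b)))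
                       - ((prodBernoulli (fun e : Sym2 (Fin n) => if (∀ y ∈ e, y ∈ B) ∧ ¬ e.IsDiag then 1 else if (∃ y ∈ e, y ∈ ({x'} : Finset (Fin n))) then 0 else u e)).real (openConn a₀ b) + (prodBernoulli (fun e : Sym2 (Fin n) => if (∀ y ∈ e, y ∈ B) ∧ ¬ e.IsDiag then 1 else if (∃ y ∈ e, y ∈ ({x'} : Finset (Fin n))) then 0 else u e)).real ((openConn a₀ b)ᶜ ∩ (⋃ v ∈ (S.erase x' ∪ B), openConn a₀ v) ∩ (⋃ v ∈ (S.erase x' ∪ B), openConn v b)))))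
            else
              ((prodBernoulli (fun e : Sym2 (Fin n) => if (∀ y ∈ e, y ∈ B) ∧ ¬ e.IsDiag then 1 else if (∃ y ∈ e, y ∈ ({x'} : Finset (Fin n))) then 0 else u e)).real (⋃ v ∈ (S.erase x' ∪ B), openConn v b)
                - ((prodBernoulli (fun e : Sym2 (Fin n) => if (∀ y ∈ e, y ∈ B) ∧ ¬ e.IsDiag then 1 else if (∃ y ∈ e, y ∈ ({x'} : Finset (Fin n))) then 0 else u e)).real (openConn a₀ b) + (prodBernoulli (fun e : Sym2 (Fin n) => if (∀ y ∈ e, y ∈ B) ∧ ¬ e.IsDiag then 1 else if (∃ y ∈ e, y ∈ ({x'} : Finset (Fin n))) then 0 else u e)).real ((openConn a₀ b)ᶜ ∩ (⋃ v ∈ (S.erase x' ∪ B), openConn a₀ v) ∩ (⋃ v ∈ (S.erase x' ∪ B), openConn v b))))) ≤ _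
  split_ifs with hdisj hmode
  · -- relay-free layer, base `q_B` with the pairs `a₀–T_B` deleted (mode B)
    have hgoodw := hblk (w B) (hwcard B hdisj hB) A (S.erase x' ∪ B) b (d B) hb hdisj (hdA B) (hwmin B hdisj hB)
    have hag : ∀ e : Sym2 (Fin n), ¬ ((∀ y ∈ e, y ∈ (S.erase x' ∪ B)) ∧ ¬ e.IsDiag) → ¬ (d B ∈ e ∧ ∃ y ∈ e, y ∈ (S.erase x' ∪ B)) →
        w B e = (fun e : Sym2 (Fin n) => if a₀ ∈ e ∧ (∃ y ∈ e, y ∈ (S.erase x' ∪ B)) then (0 : unitInterval) else if (∀ y ∈ e, y ∈ B) ∧ ¬ e.IsDiag then 1 else if (∃ y ∈ e, y ∈ ({x'} : Finset (Fin n))) then 0 else u e) e := by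
      intro e h1 h2
      rw [hwagree B hdisj hB e h1 h2, if_pos hmode]
    have hgood := blockSlack_transfer (fun e : Sym2 (Fin n) => if a₀ ∈ e ∧ (∃ y ∈ e, y ∈ (S.erase x' ∪ B)) then (0 : unitInterval) else if (∀ y ∈ e, y ∈ B) ∧ ¬ e.IsDiag then 1 else if (∃ y ∈ e, y ∈ ({x'} : Finset (Fin n))) then 0 else u e) (w B) A (S.erase x' ∪ B) b (d B) hb hdisj (hdA B) hag (hwpos B hdisj hB) hgoodw
    have hpin := kernelPin_slack_eq (fun e : Sym2 (Fin n) => if (∀ y ∈ e, y ∈ B) ∧ ¬ e.IsDiag then 1 else if (∃ y ∈ e, y ∈ ({x'} : Finset (Fin n))) then 0 else u e) A (S.erase x' ∪ B) b a₀ hb hdisj ha₀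
    have hc0 : 0 ≤ (prodBernoulli (fun e : Sym2 (Fin n) => if (∀ y ∈ e, y ∈ B) ∧ ¬ e.IsDiag then 1 else if (∃ y ∈ e, y ∈ ({x'} : Finset (Fin n))) then 0 else u e)).real {ω : BondConfig (Fin n) | ∀ y ∈ (S.erase x' ∪ B), s(a₀, y) ∉ ω} := measureReal_nonneg
    have hkey : (prodBernoulli (fun e : Sym2 (Fin n) => if (∀ y ∈ e, y ∈ B) ∧ ¬ e.IsDiag then 1 else if (∃ y ∈ e, y ∈ ({x'} : Finset (Fin n))) then 0 else u e)).real {ω : BondConfig (Fin n) | ∀ y ∈ (S.erase x' ∪ B), s(a₀, y) ∉ ω}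
          * (((prodBernoulli (fun e : Sym2 (Fin n) => if a₀ ∈ e ∧ (∃ y ∈ e, y ∈ (S.erase x' ∪ B)) then (0 : unitInterval) else if (∀ y ∈ e, y ∈ B) ∧ ¬ e.IsDiag then 1 else if (∃ y ∈ e, y ∈ ({x'} : Finset (Fin n))) then 0 else u e)).real (openConn (d B) b) + (prodBernoulli (fun e : Sym2 (Fin n) => if a₀ ∈ e ∧ (∃ y ∈ e, y ∈ (S.erase x' ∪ B)) then (0 : unitInterval) else if (∀ y ∈ e, y ∈ B) ∧ ¬ e.IsDiag then 1 else if (∃ y ∈ e, y ∈ ({x'} : Finset (Fin n))) then 0 else u e)).real ((openConn (d B) b)ᶜ ∩ (⋃ v ∈ (S.erase x' ∪ B), openConn (d B) v) ∩ (⋃ v ∈ (S.erase x' ∪ B), openConn v b)))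
             - ((prodBernoulli (fun e : Sym2 (Fin n) => if a₀ ∈ e ∧ (∃ y ∈ e, y ∈ (S.erase x' ∪ B)) then (0 : unitInterval) else if (∀ y ∈ e, y ∈ B) ∧ ¬ e.IsDiag then 1 else if (∃ y ∈ e, y ∈ ({x'} : Finset (Fin n))) then 0 else u e)).real (openConn a₀ b) + (prodBernoulli (fun e : Sym2 (Fin n) => if a₀ ∈ e ∧ (∃ y ∈ e, y ∈ (S.erase x' ∪ B)) then (0 : unitInterval) else if (∀ y ∈ e, y ∈ B) ∧ ¬ e.IsDiag then 1 else if (∃ y ∈ e, y ∈ ({x'} : Finset (Fin n))) then 0 else u e)).real ((openConn a₀ b)ᶜ ∩ (⋃ v ∈ (S.erase x' ∪ B), openConn a₀ v) ∩ (⋃ v ∈ (S.erase x' ∪ B), openConn v b))))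
        ≤ (prodBernoulli (fun e : Sym2 (Fin n) => if (∀ y ∈ e, y ∈ B) ∧ ¬ e.IsDiag then 1 else if (∃ y ∈ e, y ∈ ({x'} : Finset (Fin n))) then 0 else u e)).real {ω : BondConfig (Fin n) | ∀ y ∈ (S.erase x' ∪ B), s(a₀, y) ∉ ω} * ((prodBernoulli (fun e : Sym2 (Fin n) => if a₀ ∈ e ∧ (∃ y ∈ e, y ∈ (S.erase x' ∪ B)) then (0 : unitInterval) else if (∀ y ∈ e, y ∈ B) ∧ ¬ e.IsDiag then 1 else if (∃ y ∈ e, y ∈ ({x'} : Finset (Fin n))) then 0 else u e)).real (⋃ v ∈ (S.erase x' ∪ B), openConn v b)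
          + (∑ W ∈ (Finset.univ : Finset (Finset (Fin n))).filter (fun W => Disjoint W A),
              (prodBernoulli (fun e : Sym2 (Fin n) => if a₀ ∈ e ∧ (∃ y ∈ e, y ∈ (S.erase x' ∪ B)) then (0 : unitInterval) else if (∀ y ∈ e, y ∈ B) ∧ ¬ e.IsDiag then 1 else if (∃ y ∈ e, y ∈ ({x'} : Finset (Fin n))) then 0 else u e)).real
                  {ω : BondConfig (Fin n) | ∀ z : Fin n, (z ∈ W ↔ ω ∈ ⋃ v ∈ (S.erase x' ∪ B), openConn v z)}
                * A.inf' ⟨b, hb⟩ (fun a => (prodBernoulli (fun e : Sym2 (Fin n) => if a₀ ∈ e ∧ (∃ y ∈ e, y ∈ (S.erase x' ∪ B)) then (0 : unitInterval) else if (∀ y ∈ e, y ∈ B) ∧ ¬ e.IsDiag then 1 else if (∃ y ∈ e, y ∈ ({x'} : Finset (Fin n))) then 0 else u e)).real (openConnIn ((W : Set (Fin n))ᶜ) a b)))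
          - ((prodBernoulli (fun e : Sym2 (Fin n) => if a₀ ∈ e ∧ (∃ y ∈ e, y ∈ (S.erase x' ∪ B)) then (0 : unitInterval) else if (∀ y ∈ e, y ∈ B) ∧ ¬ e.IsDiag then 1 else if (∃ y ∈ e, y ∈ ({x'} : Finset (Fin n))) then 0 else u e)).real (openConn a₀ b) + (prodBernoulli (fun e : Sym2 (Fin n) => if a₀ ∈ e ∧ (∃ y ∈ e, y ∈ (S.erase x' ∪ B)) then (0 : unitInterval) else if (∀ y ∈ e, y ∈ B) ∧ ¬ e.IsDiag then 1 else if (∃ y ∈ e, y ∈ ({x'} : Finset (Fin n))) then 0 else u e)).real ((openConn a₀ b)ᶜ ∩ (⋃ v ∈ (S.erase x' ∪ B), openConn a₀ v) ∩ (⋃ v ∈ (S.erase x' ∪ B), openConn v b)))) := by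
      refine mul_le_mul_of_nonneg_left ?_ hc0
      linarith [hgood]
    linarith [hkey, hpin]
  · -- relay-free layer, base `q_B` (mode A)
    have hgoodw := hblk (w B) (hwcard B hdisj hB) A (S.erase x' ∪ B) b (d B) hb hdisj (hdA B) (hwmin B hdisj hB)
    have hag : ∀ e : Sym2 (Fin n), ¬ ((∀ y ∈ e, y ∈ (S.erase x' ∪ B)) ∧ ¬ e.IsDiag) → ¬ (d B ∈ e ∧ ∃ y ∈ e, y ∈ (S.erase x' ∪ B)) →
        w B e = (fun e : Sym2 (Fin n) => if (∀ y ∈ e, y ∈ B) ∧ ¬ e.IsDiag then 1 else if (∃ y ∈ e, y ∈ ({x'} : Finset (Fin n))) then 0 else u e) e := by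
      intro e h1 h2
      rw [hwagree B hdisj hB e h1 h2, if_neg hmode]
    have hgood := blockSlack_transfer (fun e : Sym2 (Fin n) => if (∀ y ∈ e, y ∈ B) ∧ ¬ e.IsDiag then 1 else if (∃ y ∈ e, y ∈ ({x'} : Finset (Fin n))) then 0 else u e) (w B) A (S.erase x' ∪ B) b (d B) hb hdisj (hdA B) hag (hwpos B hdisj hB) hgoodw
    linarith [hgood]
  · -- relay layer: only the pockets are lost
    linarith

end BystanderKernel3

end

end Summit.CriticalPhenomena.PercolationContinuityZ3.Theorems
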